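import Literature.Analysis.FunctionSpaces.TorusSobolevNormProofs
import Literature.Analysis.FunctionSpaces.TorusFourierCalculus
import HarnessLib

/-!
# The `H¹(T^d)` norm of smooth functions via gradients

Discharge of the named fact `Torus.eSobolevNorm_one_sq_eq` of
`Literature.Analysis.FunctionSpaces.TorusSobolevNorm`: for a smooth `f : T^d → F` with values in
a complete complex inner-product space `F`,

  `‖f‖²_{H¹} = ∫ ‖f‖² + (4π²)⁻¹ ∫ ∑ᵢ ‖∂ᵢ f‖²`  in `[0, ∞]`,

where `‖f‖²_{H¹} = ∑_k ⟨k⟩² ‖f̂(k)‖²`, `⟨k⟩² = 1 + |k|²`, characters `e^{2πi k·x}`.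

We follow the printed argument (Grafakos 2014, §3.1–3.3), in the same order as the tree's proof
of the special case `F = ℂ^d`, `f = complexify ∘ v` (`Torus.eSobolevNorm_one_complexify_sq`,
`TorusFourierCalculus`), the componentwise Parseval on `ℂ^d` being replaced by Plancherel in
`L²(T^d; F)` (`Torus.tsum_enorm_sq_mFourierCoeff_eq_eLpNorm_sq`, `TorusSobolevNormProofs`):

* `Torus.tsum_enorm_sq_mFourierCoeff_eq_ofReal_integral` — Plancherel `∑_k ‖f̂(k)‖² = ∫ ‖f‖²`
  for `f ∈ L²(T^d; F)`, in `ℝ≥0∞` with the Bochner integral on the right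
  (Grafakos 2014, Prop. 3.2.7 (1), PDF p. 195);
* `Torus.tsum_sq_mul_enorm_sq_mFourierCoeff` — `∑_k kⱼ² ‖f̂(k)‖² = (4π²)⁻¹ ∫ ‖∂ⱼ f‖²`, from
  `𝓕(∂ⱼ f)(k) = 2πi kⱼ f̂(k)` (Grafakos 2014, Prop. 3.1.2 (10), PDF p. 188, and eq. (3.3.9),
  PDF p. 205 — the tree's `Torus.mFourierCoeff_partialDeriv`) and Plancherel for `∂ⱼ f`;
* `Torus.tsum_freqNormSq_mul_enorm_sq_mFourierCoeff` — summed over `j`: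
  `∑_k |k|² ‖f̂(k)‖² = (4π²)⁻¹ ∫ ∑ⱼ ‖∂ⱼ f‖²`;
* `Torus.eSobolevNorm_one_sq_eq_holds` — the discharge, splitting `⟨k⟩² = 1 + |k|²`.

## References

* L. Grafakos, *Classical Fourier Analysis*, 3rd ed., GTM 249 (Springer 2014), Prop. 3.1.2 (10)
  (PDF p. 188: `𝓕(∂^α f)(m) = (2πi m)^α f̂(m)` for `f ∈ C^α(T^n)`), eq. (3.3.9) (PDF p. 205,
  integration by parts in `x_j`), Prop. 3.2.7 (1) (PDF p. 195, Plancherel on `T^n`).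
  [Grafakos2014]
* L. C. Evans, *Partial Differential Equations*, 2nd ed. (2010), §5.8.4, Thm. 8 (Fourier
  characterisation of `H^k(ℝⁿ)`). [Evans2010]
-/

open MeasureTheory Set Filter Topology UnitAddTorus
open scoped ENNReal NNReal

noncomputable section

namespace Literature.Analysis.FunctionSpaces

namespace Torus

variable {d : Type*} [Fintype d]
variable {F : Type*} [NormedAddCommGroup F] [InnerProductSpace ℂ F] [CompleteSpace F]

/-! ## Plancherel with the Bochner integral on the right -/

section Plancherel

/-- **Plancherel in `L²(T^d; F)`, integral form**: for `f ∈ L²(T^d; F)` with values in a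
Hilbert space `F`, `∑_k ‖f̂(k)‖ₑ² = ofReal (∫ ‖f‖²)` (Grafakos 2014, Prop. 3.2.7 (1), PDF p. 195;
the `eLpNorm` form is `Torus.tsum_enorm_sq_mFourierCoeff_eq_eLpNorm_sq`, and
`‖f‖²_{L²} = ∫⁻ ‖f‖ₑ² = ofReal (∫ ‖f‖²)` for `f ∈ L²`). [cite: Grafakos2014, Prop. 3.2.7 (1)] -/
theorem tsum_enorm_sq_mFourierCoeff_eq_ofReal_integral {f : UnitAddTorus d → F}
    (hf : MemLp f 2 volume) :
    ∑' k, ‖mFourierCoeff f k‖ₑ ^ 2 = ENNReal.ofReal (∫ x, ‖f x‖ ^ 2) := by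
  -- `‖f‖²_{L²} = ∫⁻ ‖f‖ₑ²`
  have hsq : eLpNorm f 2 volume ^ 2 = ∫⁻ x, ‖f x‖ₑ ^ 2 := by
    rw [eLpNorm_eq_lintegral_rpow_enorm_toReal two_ne_zero ENNReal.ofNat_ne_top,
      ENNReal.toReal_ofNat, ENNReal.rpow_half_sq]
    simp_rw [ENNReal.rpow_two]
  rw [tsum_enorm_sq_mFourierCoeff_eq_eLpNorm_sq hf, hsq,
    ofReal_integral_eq_lintegral_ofReal (hf.integrable_norm_pow two_ne_zero)
      (ae_of_all _ fun x => by positivity)]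
  refine lintegral_congr fun x => ?_
  rw [← ofReal_norm, ← ENNReal.ofReal_pow (norm_nonneg _)]

end Plancherel

/-! ## Spectral first moments of smooth functions and the `H¹` identity -/

section Deriv

variable [DecidableEq d]

/-- **Spectral first moment along one axis** (Grafakos 2014, Prop. 3.1.2 (10) / eq. (3.3.9) with
Prop. 3.2.7 (1)): for smooth `f : T^d → F`, `∑_k kⱼ² ‖f̂(k)‖ₑ² = ofReal ((4π²)⁻¹ ∫ ‖∂ⱼ f‖²)`,
since `𝓕(∂ⱼ f)(k) = 2πi kⱼ f̂(k)` (`Torus.mFourierCoeff_partialDeriv`) and Plancherel applies to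
the smooth, hence square-integrable, `∂ⱼ f`.
[cite: Grafakos2014, Prop. 3.1.2 (10) with Prop. 3.2.7 (1)] -/
theorem tsum_sq_mul_enorm_sq_mFourierCoeff {f : UnitAddTorus d → F} (hf : IsSmooth f) (j : d) :
    ∑' k : d → ℤ, ENNReal.ofReal ((k j : ℝ) ^ 2) * ‖mFourierCoeff f k‖ₑ ^ 2 =
      ENNReal.ofReal ((4 * Real.pi ^ 2)⁻¹ * ∫ x, ‖partialDeriv j f x‖ ^ 2) := by
  have hpar := tsum_enorm_sq_mFourierCoeff_eq_ofReal_integral ((hf.partialDeriv j).memLp 2)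
  simp_rw [mFourierCoeff_partialDeriv hf, enorm_smul, mul_pow] at hpar
  -- `‖2πi kⱼ‖ₑ² = ofReal (4π²) * ofReal (kⱼ²)`
  have hck : ∀ k : d → ℤ, ‖(2 * (Real.pi : ℂ) * Complex.I * (k j : ℂ))‖ₑ ^ 2 =
      ENNReal.ofReal (4 * Real.pi ^ 2) * ENNReal.ofReal ((k j : ℝ) ^ 2) := by
    intro k
    rw [← ofReal_norm, ← ENNReal.ofReal_pow (norm_nonneg _),
      ← ENNReal.ofReal_mul (by positivity)]
    congr 1
    simp only [norm_mul, Complex.norm_ofNat, Complex.norm_real, Real.norm_eq_abs,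
      Complex.norm_I, mul_one, Complex.norm_intCast, abs_of_pos Real.pi_pos]
    rw [mul_pow, mul_pow, sq_abs]
    ring
  simp_rw [hck, mul_assoc] at hpar
  rw [ENNReal.tsum_mul_left] at hpar
  have h4 : ENNReal.ofReal (4 * Real.pi ^ 2) ≠ 0 := by
    rw [Ne, ENNReal.ofReal_eq_zero, not_le]; positivity
  have h4' : ENNReal.ofReal (4 * Real.pi ^ 2) ≠ ⊤ := ENNReal.ofReal_ne_top
  rw [ENNReal.ofReal_mul (by positivity), ENNReal.ofReal_inv_of_pos (by positivity), ← hpar,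
    ← mul_assoc, ENNReal.inv_mul_cancel h4 h4', one_mul]

/-- **Spectral first moment** (Grafakos 2014, Prop. 3.1.2 (10) with Prop. 3.2.7 (1)): for smooth
`f : T^d → F`, `∑_k |k|² ‖f̂(k)‖ₑ² = ofReal ((4π²)⁻¹ ∫ ∑ⱼ ‖∂ⱼ f‖²) = ofReal ((4π²)⁻¹ ‖∇f‖₂²)`
(sum the one-axis identities over `j`, `|k|² = ∑ⱼ kⱼ²`).
[cite: Grafakos2014, Prop. 3.1.2 (10) with Prop. 3.2.7 (1)] -/
theorem tsum_freqNormSq_mul_enorm_sq_mFourierCoeff {f : UnitAddTorus d → F} (hf : IsSmooth f) :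
    ∑' k : d → ℤ, ENNReal.ofReal (freqNormSq k) * ‖mFourierCoeff f k‖ₑ ^ 2 =
      ENNReal.ofReal ((4 * Real.pi ^ 2)⁻¹ * ∫ x, ∑ j, ‖partialDeriv j f x‖ ^ 2) := by
  have hsplit : ∀ k : d → ℤ, ENNReal.ofReal (freqNormSq k) =
      ∑ j, ENNReal.ofReal ((k j : ℝ) ^ 2) := fun k => by
    rw [freqNormSq, ENNReal.ofReal_sum_of_nonneg fun j _ => sq_nonneg _]
  simp_rw [hsplit, Finset.sum_mul]
  rw [Summable.tsum_finsetSum fun j _ => ENNReal.summable]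
  simp_rw [tsum_sq_mul_enorm_sq_mFourierCoeff hf]
  rw [← ENNReal.ofReal_sum_of_nonneg fun j _ =>
      mul_nonneg (by positivity) (integral_nonneg fun x => sq_nonneg _), ← Finset.mul_sum,
    integral_finsetSum _ (f := fun j x => ‖partialDeriv j f x‖ ^ 2) fun j _ =>
      ((hf.partialDeriv j).continuous.norm.pow 2).integrable_unitAddTorus]

/-- **Discharge** of the named fact `Torus.eSobolevNorm_one_sq_eq`: **the `H¹(T^d)` norm of a
smooth function via its gradient**, `‖f‖²_{H¹} = ofReal (∫ ‖f‖² + (4π²)⁻¹ ∫ ∑ᵢ ‖∂ᵢ f‖²)` for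
smooth `f : T^d → F`, `F` a complete complex inner-product space. Proof as printed: split the
weight `⟨k⟩² = 1 + |k|²`; the first sum is Plancherel (Grafakos 2014, Prop. 3.2.7 (1)), the
second is `(4π²)⁻¹ ‖∇f‖₂²` by `𝓕(∂ⱼ f)(k) = 2πi kⱼ f̂(k)` (Prop. 3.1.2 (10), eq. (3.3.9)) and
Plancherel again. [cite: Grafakos2014, §3.3 eq. (3.3.9) with Prop. 3.2.7 (1)] -/
theorem eSobolevNorm_one_sq_eq_holds : eSobolevNorm_one_sq_eq (d := d) (F := F) := by
  intro f hf
  rw [eSobolevNorm, ENNReal.rpow_half_sq]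
  -- `⟨k⟩² = 1 + |k|²` in `ℝ≥0∞`
  have hw : ∀ k : d → ℤ,
      ENNReal.ofReal (sobolevWeight 1 k ^ 2) = 1 + ENNReal.ofReal (freqNormSq k) := by
    intro k
    rw [sobolevWeight, ← Real.rpow_natCast,
      ← Real.rpow_mul (by linarith [freqNormSq_nonneg k])]
    norm_num
    rw [ENNReal.ofReal_add zero_le_one (freqNormSq_nonneg k), ENNReal.ofReal_one]
  simp_rw [hw, add_mul, one_mul]
  rw [ENNReal.tsum_add, tsum_freqNormSq_mul_enorm_sq_mFourierCoeff hf,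
    tsum_enorm_sq_mFourierCoeff_eq_ofReal_integral (hf.memLp 2),
    ← ENNReal.ofReal_add (integral_nonneg fun x => sq_nonneg _)
      (mul_nonneg (by positivity)
        (integral_nonneg fun x => Finset.sum_nonneg fun j _ => sq_nonneg _))]

end Deriv

end Torus

end Literature.Analysis.FunctionSpaces
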